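import Literature.Barriers.RiemannHypothesis.LiouvilleSignConjecturesHaselgrove
import Literature.NumberTheory.LFunctions.HaselgroveNumericsProofs
import HarnessLib

/-!
# Haselgrove 1958 proved; the barrier `LiouvilleSignConjectures` holds unconditionally

Sibling proof file of `Literature/Barriers/RiemannHypothesis/LiouvilleSignConjectures.lean` (the
barrier) and of `LiouvilleSignConjecturesHaselgrove.lean` (which proved the two Landau halves of
Haselgrove's theorem and reduced the named fact `Haselgrove1958_signChanges` to its two Ingham halves,
`Haselgrove1958_signChanges_iff`). The Ingham halves — `L(n) > 0` and `T(n) < 0` for infinitely many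
`n` — are now theorems of the tree (`Literature.NumberTheory.LFunctions.frequently_liouvilleSum_natCast_pos`,
`Literature.NumberTheory.LFunctions.frequently_liouvilleHarmonicSum_natCast_neg`, file
`HaselgroveNumericsProofs.lean`: Ingham's kernel method for `A(u) = e^{-u/2}L(e^u)` and
`B(u) = e^{u/2}T(e^u)` with the Jurkat–Peyerimhoff kernel at Haselgrove's height `m = 1000`, the
first 649 zeros of `ζ` certified to `2⁻²⁴⁰`, and certified 90-digit evaluations giving
`A*(831.84844) > 0`, `B*(996.98037) < 0` — Borwein–Ferguson–Mossinghoff 2008, §1 (3)–(7),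
pp. 1683–1684: "Haselgrove found that selecting `m = 1000` and `y = 831.847` produces
`A*_m(y) ≈ .00495` … `y = 853.853` or `y = 996.980` produces a negative value of `B*_m(y)`"). Hence:

* `Haselgrove1958_signChanges_holds` — **discharge** of the named fact `Haselgrove1958_signChanges`
  ("both `L(x)` and `T(x)` change sign infinitely often", Mossinghoff–Trudgian 2012 §1 p. 158);
* `LiouvilleSignConjectures_holds` — **the barrier holds unconditionally**: Pólya's conjecture,
  Turán's conjecture, Titchmarsh's (14.38.1) and the eventual sign-constancy of `L` all fail
  (`LiouvilleSignConjectures_of_haselgrove`);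
* `not_turanConjecture_holds`, `TuranHypothesis1438_false`, `not_liouvilleSum_eventuallyOneSigned_holds`
  — the individual refutations (Pólya's is `PolyaConjecture_false`, `LiouvilleSignConjecturesProofs.lean`).

## Axioms

`propext`, `Classical.choice`, `Quot.sound` and the `native_decide` auxiliary axioms of the
certified computations behind `frequently_liouvilleSum_natCast_pos` /
`frequently_liouvilleHarmonicSum_natCast_neg` (the 21 Odlyzko–te Riele zero blocks and the 8
Haselgrove blocks; trust in the Lean compiler) — as the printed proof is a machine computation.
Proposal flag `computational`.

## References

* [HaselgroveMathematika1958] C. B. Haselgrove, *A disproof of a conjecture of Pólya*, Mathematika 5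
  (1958), 141–145 (main theorem).
* [BorweinFergusonMossinghoff2008] P. Borwein, R. Ferguson, M. J. Mossinghoff, *Sign changes in
  sums of the Liouville function*, Math. Comp. 77 (2008), 1681–1694: §1 pp. 1683–1684 (read).
* [MossinghoffTrudgian2012] M. J. Mossinghoff, T. S. Trudgian, *Between the problems of Pólya and
  Turán*, J. Aust. Math. Soc. 93 (2012), 157–171: §1 p. 158.
-/

noncomputable section

namespace Literature.Barriers.RiemannHypothesis

open Literature.NumberTheory.LFunctions

/-- **Haselgrove 1958 — discharge of the named fact `Haselgrove1958_signChanges`**: both `L(n)` and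
`T(n)` take positive and negative values for arbitrarily large integers `n`.
[cite: HaselgroveMathematika1958, main theorem] [cite: MossinghoffTrudgian2012, §1 p. 158]
[cite: BorweinFergusonMossinghoff2008, §1 pp. 1683–1684] -/
theorem Haselgrove1958_signChanges_holds : Haselgrove1958_signChanges :=
  Haselgrove1958_signChanges_iff.2
    ⟨frequently_liouvilleSum_natCast_pos, frequently_liouvilleHarmonicSum_natCast_neg⟩

/-- **The barrier `LiouvilleSignConjectures` holds**: Pólya's conjecture `L(n) ≤ 0 (n ≥ 2)`, Turán's
conjecture `T(n) > 0 (n ≥ 1)`, Titchmarsh's hypothesis (14.38.1) `T(x) ≥ 0 (x > 0)` and the eventual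
one-signedness of `L(n)` are all false — so the criteria of Pólya (1919), Ingham (1942) and Turán
(1948) yield the Riemann hypothesis only vacuously (`liouvilleRoutes_vacuous`).
[cite: HaselgroveMathematika1958, main theorem] [cite: MossinghoffTrudgian2012, §1 p. 158] -/
theorem LiouvilleSignConjectures_holds : LiouvilleSignConjectures :=
  LiouvilleSignConjectures_of_haselgrove Haselgrove1958_signChanges_holds

/-- **Turán's conjecture is false**: `T(n) > 0` fails for some (indeed infinitely many) `n ≥ 1`
(the deprecated Prop `TuranConjecture`, written inline).
[cite: HaselgroveMathematika1958, main theorem] [cite: BorweinFergusonMossinghoff2008, §1 p. 1684] -/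
theorem not_turanConjecture_holds :
    ¬ ∀ n : ℕ, 1 ≤ n → 0 < liouvilleHarmonicSum n :=
  LiouvilleSignConjectures_holds.2.1

/-- **Titchmarsh's (14.38.1) is false** ("Haselgrove proved that (14.38.1) is false in general",
Titchmarsh §14.38). [cite: Titchmarsh1986, §14.38] [cite: HaselgroveMathematika1958, main theorem] -/
theorem TuranHypothesis1438_false : ¬ TuranHypothesis1438 :=
  LiouvilleSignConjectures_holds.2.2.1

/-- **`L(n)` is not eventually of one sign** (the hypothesis of Pólya's 1919 criterion and of
Ingham's 1942 theorem fails; the deprecated Prop `LiouvilleSumEventuallyOneSigned`, written inline).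
[cite: HaselgroveMathematika1958, main theorem] [cite: MossinghoffTrudgian2012, §1 p. 158] -/
theorem not_liouvilleSum_eventuallyOneSigned_holds :
    ¬ ∃ N : ℕ, (∀ n : ℕ, N ≤ n → liouvilleSum n ≤ 0) ∨ (∀ n : ℕ, N ≤ n → 0 ≤ liouvilleSum n) :=
  LiouvilleSignConjectures_holds.2.2.2

end Literature.Barriers.RiemannHypothesis
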